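import Summits.NavierStokesRegularity.NavierStokesRegularity.Theorems.TerminalTraceTypeITraceScarL3SqrtTwoApexConsequences
import HarnessLib

noncomputable section
set_option linter.dupNamespace false
namespace Summit.NavierStokesRegularity.NavierStokesRegularity.Cruxes.TypeITraceScarL3.SqrtTwoApexCheck
open MeasureTheory Set Function Filter Topology Metric
open Literature.Analysis.FluidPDE
open Summit.NavierStokesRegularity.NavierStokesRegularity.Theorems.TypeITraceScarL3
open scoped NNReal ENNReal InnerProductSpace RealInnerProductSpace

def ApexPackage (M D₀ : ℝ≥0) (C : ℝ)
    (U : ℝ → EuclideanSpace ℝ (Fin 3) → EuclideanSpace ℝ (Fin 3))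
    (P : ℝ → EuclideanSpace ℝ (Fin 3) → ℝ)
    (G : ℝ → EuclideanSpace ℝ (Fin 3) → EuclideanSpace ℝ (Fin 3) →L[ℝ] EuclideanSpace ℝ (Fin 3)) :
    Prop :=
  (∀ a : ℝ, 0 < a →
      IsSuitableWeakSolutionInBall a (0 : ℝ × EuclideanSpace ℝ (Fin 3)) U P) ∧
  (∀ a : ℝ, 0 < a →
      HasWeakSpatialGradientOn
        (parabolicCylinderOpens a (0 : ℝ × EuclideanSpace ℝ (Fin 3))) U G) ∧
  (∀ a : ℝ, 0 < a →
      typeIBound (parabolicCylinder a (0 : ℝ × EuclideanSpace ℝ (Fin 3))) U P G ≤ M) ∧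
  (∀ z₀ : ℝ × EuclideanSpace ℝ (Fin 3), z₀.1 ≤ 0 →
      ∀ r : ℝ, 0 < r → cknD r z₀ P ≤ D₀) ∧
  (∀ s : ℝ, s < 0 →
      ∀ᵐ y : EuclideanSpace ℝ (Fin 3), ‖U s y‖ ≤ C / Real.sqrt (-s)) ∧
  (∀ φ : EuclideanSpace ℝ (Fin 3) → EuclideanSpace ℝ (Fin 3),
      ContDiff ℝ (⊤ : ℕ∞) φ →
      HasCompactSupport φ → ∀ ε : ℝ, 0 < ε →
      ∃ s₀ : ℝ, s₀ < 0 ∧ ∀ᵐ s ∂(volume.restrict (Ioo s₀ 0)), |∫ y, ⟪U s y, φ y⟫| ≤ ε)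


def RateSqThreshold : Prop :=
  ∀ (M D₀ : ℝ≥0) (C : ℝ)
    (U : ℝ → EuclideanSpace ℝ (Fin 3) → EuclideanSpace ℝ (Fin 3))
    (P : ℝ → EuclideanSpace ℝ (Fin 3) → ℝ)
    (G : ℝ → EuclideanSpace ℝ (Fin 3) →
      EuclideanSpace ℝ (Fin 3) →L[ℝ] EuclideanSpace ℝ (Fin 3)),
    (∀ a : ℝ, 0 < a →
      IsSuitableWeakSolutionInBall a (0 : ℝ × EuclideanSpace ℝ (Fin 3)) U P) →
    (∀ a : ℝ, 0 < a →
      HasWeakSpatialGradientOn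
        (parabolicCylinderOpens a (0 : ℝ × EuclideanSpace ℝ (Fin 3))) U G) →
    (∀ a : ℝ, 0 < a →
      typeIBound (parabolicCylinder a (0 : ℝ × EuclideanSpace ℝ (Fin 3))) U P G ≤ M) →
    (∀ z₀ : ℝ × EuclideanSpace ℝ (Fin 3), z₀.1 ≤ 0 →
      ∀ r : ℝ, 0 < r → cknD r z₀ P ≤ D₀) →
    (∀ s : ℝ, s < 0 →
      ∀ᵐ y : EuclideanSpace ℝ (Fin 3), ‖U s y‖ ≤ C / Real.sqrt (-s)) →
    (∀ φ : EuclideanSpace ℝ (Fin 3) → EuclideanSpace ℝ (Fin 3),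
      ContDiff ℝ (⊤ : ℕ∞) φ →
      HasCompactSupport φ → ∀ ε : ℝ, 0 < ε →
      ∃ s₀ : ℝ, s₀ < 0 ∧ ∀ᵐ s ∂(volume.restrict (Ioo s₀ 0)), |∫ y, ⟪U s y, φ y⟫| ≤ ε) →
    IsBackwardSingularPoint U (0 : ℝ × EuclideanSpace ℝ (Fin 3)) →
    ∀ (A R δ K : ℝ), 1 < A → 0 < R → 0 < δ →
      (∀ᵐ z ∂(volume.restrict
        (Ioo (-δ) 0 ×ˢ {y : EuclideanSpace ℝ (Fin 3) | R < ‖y‖ ∧ ‖y‖ < A * R})),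
          ‖U z.1 z.2‖ ≤ K) →
      2 ≤ C ^ 2


def ExtinctApexDOfL3TraceConst : Prop :=
  ∀ (ν T : ℝ), 0 < ν → 0 < T →
    ∀ (u : ℝ → EuclideanSpace ℝ (Fin 3) → EuclideanSpace ℝ (Fin 3))
      (p : ℝ → EuclideanSpace ℝ (Fin 3) → ℝ),
    IsClassicalNSSolutionOn (Ico 0 T) ν 0 u p → IsLerayHopfOn T ν 0 (u 0) u →
    ∀ C : ℝ, 0 ≤ C → (∀ᶠ t in 𝓝[<] T, ∀ x, ‖u t x‖ ≤ C / Real.sqrt (T - t)) →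
    ∀ x₀ : EuclideanSpace ℝ (Fin 3),
    (∃ r₀ : ℝ, 0 < r₀ ∧
      ∃ G : ℝ → EuclideanSpace ℝ (Fin 3) →
        EuclideanSpace ℝ (Fin 3) →L[ℝ] EuclideanSpace ℝ (Fin 3),
        HasWeakSpatialGradientOn (parabolicCylinderOpens r₀ (T, x₀)) u G ∧
        typeIBound (parabolicCylinder r₀ (T, x₀)) u p G < ∞) →
    (∀ r : ℝ, 0 < r →
      eLpNorm (uncurry u) ⊤ (volume.restrict (parabolicCylinder r (T, x₀))) = ⊤) →
    (∃ ρ : ℝ, 0 < ρ ∧ MemLp (u T) 3 (volume.restrict (ball x₀ ρ))) →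
      ∃ (U : ℝ → EuclideanSpace ℝ (Fin 3) → EuclideanSpace ℝ (Fin 3))
        (P : ℝ → EuclideanSpace ℝ (Fin 3) → ℝ)
        (G : ℝ → EuclideanSpace ℝ (Fin 3) →
          EuclideanSpace ℝ (Fin 3) →L[ℝ] EuclideanSpace ℝ (Fin 3))
        (M D₀ : ℝ≥0),
        ApexPackage M D₀ (C / Real.sqrt ν) U P G ∧
        IsBackwardSingularPoint U (0 : ℝ × EuclideanSpace ℝ (Fin 3))


/-- KERNEL CHECK: p2's `RateSqThreshold` (R27 v2 l.128, text verbatim above) IS the landed theorem. -/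
example : RateSqThreshold := two_le_rateSq_of_quietShell

/-- KERNEL CHECK: p2's `ExtinctApexDOfL3TraceConst` (R27 v2 l.814) IS the landed theorem (ApexPackage unfolded). -/
example : ExtinctApexDOfL3TraceConst := by
  intro ν T hν hT u p hcl hLH C hC0 hC x₀ hloc hsing htr
  obtain ⟨U, P, G, M, D₀, h1, h2, h3, h4, h5, h6, h7⟩ := extinctApexD_of_L3trace_const ν T hν hT u p hcl hLH C hC0 hC x₀ hloc hsing htr
  exact ⟨U, P, G, M, D₀, ⟨h1, h2, h3, h4, h5, h6⟩, h7⟩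

end Summit.NavierStokesRegularity.NavierStokesRegularity.Cruxes.TypeITraceScarL3.SqrtTwoApexCheck
end
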